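import Mathlib

/-!
# `MatrixDescartes` census — W4 boundary layer: the CIRCUIT ROW of an alternating trinomial (the correct «triple row»)

HONEST FRAMING.  Object-search cell `pub-symmetroid`, item `DoorA26 = PosRootLawAt 2 6 19` (stmt-ValiantsHypothesis-19979, OPEN,
typed, never asserted).  The boundary-layer face-row LPs (engine-2 g26, FACELP-E2G26; THEOREM GB in `…CensusGramBlockBoundary`)
bound the coefficients of a HYPOTHETICAL Descartes-sharp hull-edge form through «triple rows»: killing all but three positions
`e_r < e_s < e_u` by Euler twists (≤ 1 positive root each, with multiplicity) leaves an alternating trinomial that must keep two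
positive roots.  The filed LP used `(m_s f_s)² ≥ 4(m_r f_r)(m_u f_u)` for EVERY triple; that is the necessary condition only when
`e_s − e_r = e_u − e_s` (custody note TRIPLEROW-ERRATUM-E1G24: `1 − (19/10)X + X⁴` has two positive roots and `(19/10)² < 4`).
This file puts the CORRECT row in the kernel, for any spacing `p = e_s − e_r`, `q = e_u − e_s`: if `α X^r − β X^{r+p} + γ X^{r+p+q}`
(`α, γ > 0`) has a positive root then `β > 0` and `β^{p+q}·q^q·p^p ≥ (p+q)^{p+q}·α^q·γ^p` (`circuit_row_of_posRoot`) — the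
circuit number `Θ = (p+q)·α^{q/(p+q)}γ^{p/(p+q)}/(p^{p/(p+q)}q^{q/(p+q)})` of Iliman–de Wolff (tree anchor for the even-exponent
real-line version: `Literature.Algebra.Polynomial.CircuitTrinomial.trinomial_nonneg_iff`); equivalently
(`countP_posRoots_trinomial_eq_zero_of_circuit`) below the circuit number the trinomial has NO positive root.  Proof: weighted
AM–GM (`Real.geom_mean_le_arith_mean2_weighted`) on `((p+q)/q)·α` and `((p+q)/p)·γu^{p+q}` with weights `q/(p+q)`, `p/(p+q)`.
A tool for typing corrected face-row certificates; it kills nothing by itself.  Nothing here bounds `ζ_sym(2,6)`, decides `DoorA26`,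
or bears on `MatrixDescartes` (stmt-ValiantsHypothesis-18050) / `VP ≠ VNP`.
-/

-- `Summit.ValiantsHypothesis.ValiantsHypothesis.…` repeats a component by the D-0017 layout
-- (single-conjunct summit), which the `dupNamespace` linter flags; the name is mandated.
set_option linter.dupNamespace false

namespace Summit.ValiantsHypothesis.ValiantsHypothesis.Theorems.LacunarySymmetroidMatrixDescartes.Census

open Polynomial

/-- **Circuit inequality (weighted AM–GM).**  For `α, γ > 0`, naturals `p, q > 0` and every `u > 0`:
`α + γ·u^{p+q} ≥ Θ·u^p` with `Θ^{p+q} = (p+q)^{p+q} α^q γ^p / (q^q p^p)`; stated without roots: if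
`β^{p+q}·q^q·p^p < (p+q)^{p+q}·α^q·γ^p` and `β > 0` then `β·u^p < α + γ·u^{p+q}`.
[cite: IlimanDewolff2016, Theorem 3.8 (n = 1), the circuit number of a trinomial] -/
theorem circuit_lt (α β γ u : ℝ) (p q : ℕ) (hα : 0 < α) (hγ : 0 < γ) (hu : 0 < u) (hp : 0 < p) (hq : 0 < q)
    (hcirc : β ^ (p + q) * ((q : ℝ) ^ q * (p : ℝ) ^ p) < ((p + q : ℕ) : ℝ) ^ (p + q) * (α ^ q * γ ^ p)) :
    β * u ^ p < α + γ * u ^ (p + q) := by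
  have hp' : (0 : ℝ) < p := by exact_mod_cast hp
  have hq' : (0 : ℝ) < q := by exact_mod_cast hq
  have hpq : (0 : ℝ) < (p : ℝ) + q := by positivity
  -- weights
  set θ : ℝ := (q : ℝ) / ((p : ℝ) + q) with hθ
  set θ' : ℝ := (p : ℝ) / ((p : ℝ) + q) with hθ'
  have hθ0 : 0 < θ := div_pos hq' hpq
  have hθ'0 : 0 < θ' := div_pos hp' hpq
  have hθ1 : θ + θ' = 1 := by rw [hθ, hθ']; field_simp; ring
  -- the two AM-GM terms
  set a : ℝ := ((p : ℝ) + q) / q * α with ha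
  set b : ℝ := ((p : ℝ) + q) / p * (γ * u ^ (p + q)) with hb
  have ha0 : 0 < a := by rw [ha]; positivity
  have hb0 : 0 < b := by rw [hb]; positivity
  have amgm := Real.geom_mean_le_arith_mean2_weighted hθ0.le hθ'0.le ha0.le hb0.le hθ1
  -- θ a + θ' b = α + γ u^{p+q}
  have hsum : θ * a + θ' * b = α + γ * u ^ (p + q) := by
    rw [hθ, hθ', ha, hb]; field_simp
  rw [hsum] at amgm
  -- a^θ b^θ' = Θ u^p where Θ := (((p+q)/q) α)^θ (((p+q)/p) γ)^θ'
  set Θ : ℝ := (((p : ℝ) + q) / q * α) ^ θ * (((p : ℝ) + q) / p * γ) ^ θ' with hΘ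
  have hΘ0 : 0 < Θ := by rw [hΘ]; positivity
  have hgm : a ^ θ * b ^ θ' = Θ * u ^ p := by
    rw [hΘ, ha, hb]
    have hu' : 0 ≤ u ^ (p + q) := by positivity
    rw [show ((p : ℝ) + q) / p * (γ * u ^ (p + q)) = (((p : ℝ) + q) / p * γ) * u ^ (p + q) by ring,
      Real.mul_rpow (by positivity) hu']
    have hup : (u ^ (p + q) : ℝ) ^ θ' = u ^ p := by
      rw [← Real.rpow_natCast u (p + q), ← Real.rpow_mul hu.le, hθ']
      rw [show ((p + q : ℕ) : ℝ) * ((p : ℝ) / ((p : ℝ) + q)) = (p : ℝ) by push_cast; field_simp]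
      exact Real.rpow_natCast u p
    rw [hup]; ring
  rw [hgm] at amgm
  -- Θ^{p+q} = (p+q)^{p+q} α^q γ^p / (q^q p^p) > β^{p+q}  ⇒ Θ > β
  have hΘpow : Θ ^ (p + q) = ((p + q : ℕ) : ℝ) ^ (p + q) * (α ^ q * γ ^ p) / ((q : ℝ) ^ q * (p : ℝ) ^ p) := by
    rw [hΘ, mul_pow, ← Real.rpow_natCast (( ((p : ℝ) + q) / q * α) ^ θ) (p + q), ← Real.rpow_mul (by positivity),
      ← Real.rpow_natCast ((((p : ℝ) + q) / p * γ) ^ θ') (p + q), ← Real.rpow_mul (by positivity), hθ, hθ']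
    rw [show (q : ℝ) / ((p : ℝ) + q) * ((p + q : ℕ) : ℝ) = (q : ℕ) by push_cast; field_simp,
      show (p : ℝ) / ((p : ℝ) + q) * ((p + q : ℕ) : ℝ) = (p : ℕ) by push_cast; field_simp,
      Real.rpow_natCast, Real.rpow_natCast, mul_pow, mul_pow, div_pow, div_pow]
    push_cast
    field_simp
    ring
  have hβΘ : β < Θ := by
    by_contra h
    have h' : Θ ≤ β := not_lt.mp h
    have : Θ ^ (p + q) ≤ β ^ (p + q) := pow_le_pow_left₀ hΘ0.le h' _
    rw [hΘpow, div_le_iff₀ (by positivity)] at this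
    linarith
  calc β * u ^ p < Θ * u ^ p := mul_lt_mul_of_pos_right hβΘ (pow_pos hu p)
    _ ≤ α + γ * u ^ (p + q) := amgm

/-- **The circuit row for an alternating trinomial (any spacing).**  For `α, γ > 0`, naturals `r` and `p, q > 0`: if the
trinomial `α X^r − β X^{r+p} + γ X^{r+p+q}` has a positive root then `β > 0` and
`β^{p+q}·q^q·p^p ≥ (p+q)^{p+q}·α^q·γ^p` — the CIRCUIT NUMBER bound `β ≥ (p+q)·α^{q/(p+q)}γ^{p/(p+q)}/(p^{p/(p+q)}q^{q/(p+q)})`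
(weighted AM–GM; for `p = q` it reads `β² ≥ 4αγ`, and ONLY then).  Contrapositive form: under the strict reverse inequality (or
`β ≤ 0`) the trinomial has NO positive root, multiplicities included. [cite: IlimanDewolff2016, Theorem 3.8 (n = 1)] -/
theorem countP_posRoots_trinomial_eq_zero_of_circuit (α β γ : ℝ) (r p q : ℕ) (hα : 0 < α) (hγ : 0 < γ) (hp : 0 < p)
    (hq : 0 < q)
    (hcirc : β ≤ 0 ∨ β ^ (p + q) * ((q : ℝ) ^ q * (p : ℝ) ^ p) < ((p + q : ℕ) : ℝ) ^ (p + q) * (α ^ q * γ ^ p)) :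
    ((C α * X ^ r - C β * X ^ (r + p) + C γ * X ^ (r + p + q) : ℝ[X]).roots.countP (fun x => 0 < x)) = 0 := by
  classical
  rw [Multiset.countP_eq_zero]
  intro x hx hx0
  have hne : (C α * X ^ r - C β * X ^ (r + p) + C γ * X ^ (r + p + q) : ℝ[X]) ≠ 0 := by
    intro h
    have h0 := congrArg (fun P => P.coeff r) h
    simp only [coeff_add, coeff_sub, coeff_C_mul, coeff_X_pow, coeff_zero, if_true] at h0
    rw [if_neg (by omega), if_neg (by omega)] at h0
    simp at h0
    exact hα.ne' h0
  rw [mem_roots hne, IsRoot.def] at hx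
  simp only [eval_add, eval_sub, eval_mul, eval_C, eval_X, eval_pow] at hx
  -- α x^r − β x^{r+p} + γ x^{r+p+q} = x^r (α − β x^p + γ x^{p+q}) > 0
  have hpos : 0 < α - β * x ^ p + γ * x ^ (p + q) := by
    rcases hcirc with hβ | hc
    · have : β * x ^ p ≤ 0 := mul_nonpos_of_nonpos_of_nonneg hβ (pow_pos hx0 p).le
      have : 0 < γ * x ^ (p + q) := by positivity
      linarith
    · have := circuit_lt α β γ x p q hα hγ hx0 hp hq hc
      linarith
  have : α * x ^ r - β * x ^ (r + p) + γ * x ^ (r + p + q) = x ^ r * (α - β * x ^ p + γ * x ^ (p + q)) := by ring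
  rw [this] at hx
  exact (mul_pos (pow_pos hx0 r) hpos).ne' hx

/-- **The circuit row.**  If the alternating trinomial `α X^r − β X^{r+p} + γ X^{r+p+q}` (`α, γ > 0`, `p, q > 0`) has a positive
root — in particular if it keeps two positive roots with multiplicity after Euler twists of a Descartes-sharp form — then `β > 0` and
`(p+q)^{p+q}·α^q·γ^p ≤ β^{p+q}·q^q·p^p`, i.e. `(p+q)·log β − q·log α − p·log γ ≥ log((p+q)^{p+q}/(q^q p^p))`: the face-row LP's triple
row with the CORRECT normal `(p+q, −q, −p)` (engine-1 g24, TRIPLEROW-ERRATUM-E1G24; the filed normal `(2, −1, −1)` with constant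
`log 4` is the case `p = q` only). [cite: IlimanDewolff2016, Theorem 3.8 (n = 1)] -/
theorem circuit_row_of_posRoot (α β γ : ℝ) (r p q : ℕ) (hα : 0 < α) (hγ : 0 < γ) (hp : 0 < p) (hq : 0 < q)
    (hroot : 0 < ((C α * X ^ r - C β * X ^ (r + p) + C γ * X ^ (r + p + q) : ℝ[X]).roots.countP (fun x => 0 < x))) :
    0 < β ∧ ((p + q : ℕ) : ℝ) ^ (p + q) * (α ^ q * γ ^ p) ≤ β ^ (p + q) * ((q : ℝ) ^ q * (p : ℝ) ^ p) := by
  by_contra h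
  rw [not_and_or, not_lt, not_le] at h
  have := countP_posRoots_trinomial_eq_zero_of_circuit α β γ r p q hα hγ hp hq h
  omega

/-- **The circuit row, sign-free packaging for the face-row LP.**  For a trinomial `A X^r + B X^{r+p} + D X^{r+p+q}` with
`p, q > 0` whose outer coefficients have the same sign (`A·D > 0`) and which has a positive root (counted with multiplicity):
`(p+q)^{p+q}·|A|^q·|D|^p ≤ |B|^{p+q}·q^q·p^p` — the inequality the corrected face-row LP files as
`(p+q)·log|B| − q·log|A| − p·log|D| ≥ log((p+q)^{p+q}/(q^q p^p))` (after the twist multipliers are absorbed into `A, B, D`).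
Both orientations reduce to `circuit_row_of_posRoot` (negate the trinomial when `A < 0`; `roots` is negation-invariant).
[cite: IlimanDewolff2016, Theorem 3.8 (n = 1)] -/
theorem circuit_row_abs_of_posRoot (A B D : ℝ) (r p q : ℕ) (hAD : 0 < A * D) (hp : 0 < p) (hq : 0 < q)
    (hroot : 0 < ((C A * X ^ r + C B * X ^ (r + p) + C D * X ^ (r + p + q) : ℝ[X]).roots.countP (fun x => 0 < x))) :
    ((p + q : ℕ) : ℝ) ^ (p + q) * (|A| ^ q * |D| ^ p) ≤ |B| ^ (p + q) * ((q : ℝ) ^ q * (p : ℝ) ^ p) := by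
  rcases lt_or_gt_of_ne (show A ≠ 0 from fun h => by rw [h, zero_mul] at hAD; exact lt_irrefl _ hAD) with hA | hA
  · -- `A < 0 < ... D < 0`: negate
    have hD : D < 0 := by
      by_contra h
      have : A * D ≤ 0 := mul_nonpos_of_nonpos_of_nonneg hA.le (not_lt.mp h)
      linarith
    have hneg : (C (-A) * X ^ r - C B * X ^ (r + p) + C (-D) * X ^ (r + p + q) : ℝ[X])
        = -(C A * X ^ r + C B * X ^ (r + p) + C D * X ^ (r + p + q)) := by
      simp only [map_neg]; ring
    have hroot' : 0 < ((C (-A) * X ^ r - C B * X ^ (r + p) + C (-D) * X ^ (r + p + q) : ℝ[X]).roots.countP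
        (fun x => 0 < x)) := by rwa [hneg, roots_neg]
    obtain ⟨hB, hle⟩ := circuit_row_of_posRoot (-A) B (-D) r p q (by linarith) (by linarith) hp hq hroot'
    rw [abs_of_neg hA, abs_of_neg hD, abs_of_pos hB]
    exact hle
  · have hD : 0 < D := pos_of_mul_pos_right hAD hA.le
    have hneg : (C A * X ^ r - C (-B) * X ^ (r + p) + C D * X ^ (r + p + q) : ℝ[X])
        = C A * X ^ r + C B * X ^ (r + p) + C D * X ^ (r + p + q) := by
      simp only [map_neg]; ring
    have hroot' : 0 < ((C A * X ^ r - C (-B) * X ^ (r + p) + C D * X ^ (r + p + q) : ℝ[X]).roots.countP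
        (fun x => 0 < x)) := by rwa [hneg]
    obtain ⟨hB, hle⟩ := circuit_row_of_posRoot A (-B) D r p q hA hD hp hq hroot'
    rw [abs_of_pos hA, abs_of_pos hD, show |B| = -B from abs_of_neg (by linarith)]
    exact hle

end Summit.ValiantsHypothesis.ValiantsHypothesis.Theorems.LacunarySymmetroidMatrixDescartes.Census
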